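/-
Origin: expansion seat `planner-pub-hodgecm-pv03-g6-0`, handover #2 2026-08-18T10:32:56Z (`HOME/pub-hodgecm-pv03-g6/lean/Pv03g6/Restrict.lean`, md5 6b08117b, 312 lines);
landed by the gen-7 packager in gate run 28 as `HodgeCM/Model/ToyG2/Restrict.lean` (verbatim).
-/
/-
Copyright (c) 2026. All rights reserved.
Released under Apache 2.0 license as described in the file LICENSE.
-/
import Mathlib
import Summits.HodgeConjecture.HodgeCM.StubTree.Inputs

/-!
# Restricting a geometric universe to a constructor-closed class of varieties

Seat `planner-pub-hodgecm-pv03-g6-0` (DAG-node prover #03, gen 6), node (U-CM) of the G4 consistency target.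

Given a universe `U : HodgeCM.Universe` and a predicate `Q` on `U.Var` that is closed under the three
CONSTRUCTORS of the signature (`prod`, `cmAV`, `pms` — `Universe.SubClosed`), the full sub-universe
`U.restrictObj Q hQ` has varieties `{X // Q X}` and every other primitive (cohomology, Hodge structures, algebraic
classes, morphisms, pull-backs, cups, traces, projections, CM actions) INHERITED from `U` along `Subtype.val`.

Everything is then transported along the inclusion:
* each of the 28 named facts `U.Fact_* → (U.restrictObj Q hQ).Fact_*` (`restrictObj_pull_id`, …, `restrictObj_algDuality`;
  only `Fact_cmDominated` needs an argument — the iterated product `prodFin` commutes with `Subtype.val`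
  (`prodFin_restrictObj_val`) and the dominating morphisms are cast along that equality (`Mor.castR/castL`,
  `comp_castR_castL`)), hence `ModelAxioms.restrictObj`;
* theta realisations `U.ThetaRealisation ι₁ V K Ψ σ → (U.restrictObj Q hQ).ThetaRealisation ι₁ V K Ψ σ`
  (`ThetaRealisation.restrictObj`, a field-by-field copy: `pms`, `CohC`, `Uiso`, `H10`, `period` of the
  sub-universe are those of `U` definitionally), hence `restrictObj_realisationExistsPerL/Face`.

Purpose (`G4WitnessCM.lean`): the 28th model axiom M26 (Gysin) is available in the generation-2 toy universe
only for objects carrying conjugation data (`hodgeRiesz_of_conjData`), a constructor-closed class; the other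
27 axioms and the two realisation inputs, proved for the whole toy universe by the toy-g2 / pv03-g5 seats,
descend to that class by the present file.  Nothing here is specific to the toy model.
-/

namespace HodgeCM.Universe

open Literature.AlgebraicGeometry.Motives

noncomputable section

variable (U : Universe)

/-- a class of varieties closed under the universe's three constructors -/
structure SubClosed (Q : U.Var → Prop) : Prop where
  prod : ∀ X Y, Q X → Q Y → Q (U.prod X Y)
  cmAV : ∀ (K : CMField) (Φ : CMType K), Q (U.cmAV K Φ)
  pms : ∀ (L : CMField) (ι₁ : L →+* ℂ) (V : HermSpace3 L ι₁) (Γ : Level V), Q (U.pms L ι₁ V Γ)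

/-- **the full sub-universe on a constructor-closed class of varieties** -/
@[reducible] def restrictObj (Q : U.Var → Prop) (hQ : U.SubClosed Q) : Universe where
  Var := {X : U.Var // Q X}
  dim X := U.dim X.1
  Coh X k := U.Coh X.1 k
  hodge X k := U.hodge X.1 k
  alg X p := U.alg X.1 p
  Mor X Y := U.Mor X.1 Y.1
  idMor X := U.idMor X.1
  comp f g := U.comp f g
  pull f k := U.pull f k
  cup X i j := U.cup X.1 i j
  tr X k := U.tr X.1 k
  prod X Y := ⟨U.prod X.1 Y.1, hQ.prod _ _ X.2 Y.2⟩
  fst X Y := U.fst X.1 Y.1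
  snd X Y := U.snd X.1 Y.1
  IsAbelianVariety X := U.IsAbelianVariety X.1
  IsCMAbelianVariety X := U.IsCMAbelianVariety X.1
  cmAV K Φ := ⟨U.cmAV K Φ, hQ.cmAV K Φ⟩
  cmAct K Φ := U.cmAct K Φ
  pms L ι₁ V Γ := ⟨U.pms L ι₁ V Γ, hQ.pms L ι₁ V Γ⟩

variable {U} {Q : U.Var → Prop} (hQ : U.SubClosed Q)

section defeq
/-! ### The derived operations of the sub-universe are those of `U` (all `rfl`) -/

variable (X : (U.restrictObj Q hQ).Var)

/-- (Ported verbatim from the HodgeCMPerL package; no docstring in the source.) -/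
lemma restrictObj_val_prod (Y : (U.restrictObj Q hQ).Var) : ((U.restrictObj Q hQ).prod X Y).1 = U.prod X.1 Y.1 := rfl
/-- (Ported verbatim from the HodgeCMPerL package; no docstring in the source.) -/
lemma restrictObj_val_cmAV (K : CMField) (Φ : CMType K) : ((U.restrictObj Q hQ).cmAV K Φ).1 = U.cmAV K Φ := rfl
/-- (Ported verbatim from the HodgeCMPerL package; no docstring in the source.) -/
lemma restrictObj_val_pms (L : CMField) (ι₁ : L →+* ℂ) (V : HermSpace3 L ι₁) (Γ : Level V) :
    ((U.restrictObj Q hQ).pms L ι₁ V Γ).1 = U.pms L ι₁ V Γ := rfl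
/-- (Ported verbatim from the HodgeCMPerL package; no docstring in the source.) -/
lemma restrictObj_val_prod4 (K : CMField) (Φ : Fin 4 → CMType K) :
    ((U.restrictObj Q hQ).prod4 K Φ).1 = U.prod4 K Φ := rfl
/-- (Ported verbatim from the HodgeCMPerL package; no docstring in the source.) -/
lemma restrictObj_hodgeClassesOf (p : ℕ) : (U.restrictObj Q hQ).hodgeClassesOf X p = U.hodgeClassesOf X.1 p := rfl
/-- (Ported verbatim from the HodgeCMPerL package; no docstring in the source.) -/
lemma restrictObj_CohC (k : ℕ) : (U.restrictObj Q hQ).CohC X k = U.CohC X.1 k := rfl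
/-- (Ported verbatim from the HodgeCMPerL package; no docstring in the source.) -/
lemma restrictObj_H10 : (U.restrictObj Q hQ).H10 X = U.H10 X.1 := rfl
/-- (Ported verbatim from the HodgeCMPerL package; no docstring in the source.) -/
lemma restrictObj_period (ω : Fin 4 → U.CohC X.1 1) : (U.restrictObj Q hQ).period X ω = U.period X.1 ω := rfl
/-- (Ported verbatim from the HodgeCMPerL package; no docstring in the source.) -/
lemma restrictObj_eigenLine (K : CMField) (Φ : CMType K) (σ : K →+* ℂ) :
    (U.restrictObj Q hQ).eigenLine K Φ σ = U.eigenLine K Φ σ := rfl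
/-- (Ported verbatim from the HodgeCMPerL package; no docstring in the source.) -/
lemma restrictObj_alphaLine (K : CMField) (Φ : CMType K) (σ : K →+* ℂ) :
    (U.restrictObj Q hQ).alphaLine K Φ σ = U.alphaLine K Φ σ := rfl
/-- (Ported verbatim from the HodgeCMPerL package; no docstring in the source.) -/
lemma restrictObj_pr4 (K : CMField) (Φ : Fin 4 → CMType K) (i : Fin 4) :
    (U.restrictObj Q hQ).pr4 K Φ i = U.pr4 K Φ i := by
  fin_cases i <;> rfl
/-- (Ported verbatim from the HodgeCMPerL package; no docstring in the source.) -/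
lemma restrictObj_weilGenerators (K : CMField) (Φ : Fin 4 → CMType K) :
    (U.restrictObj Q hQ).weilGenerators K Φ = U.weilGenerators K Φ := by
  ext x
  simp only [Universe.weilGenerators, Set.mem_setOf_eq, restrictObj_pr4]
  rfl
/-- (Ported verbatim from the HodgeCMPerL package; no docstring in the source.) -/
lemma restrictObj_weilLine (K : CMField) (Φ : Fin 4 → CMType K) :
    (U.restrictObj Q hQ).weilLine K Φ = U.weilLine K Φ := by
  rw [Universe.weilLine, Universe.weilLine, restrictObj_weilGenerators]
/-- (Ported verbatim from the HodgeCMPerL package; no docstring in the source.) -/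
lemma restrictObj_isDiagAct (K : CMField) (Φ : Fin 4 → CMType K) (a : K)
    (M : U.Mor (U.prod4 K Φ) (U.prod4 K Φ)) :
    (U.restrictObj Q hQ).IsDiagAct K Φ a M ↔ U.IsDiagAct K Φ a M := by
  simp only [Universe.IsDiagAct, restrictObj_pr4]
/-- (Ported verbatim from the HodgeCMPerL package; no docstring in the source.) -/
lemma restrictObj_Uiso {L : CMField} {ι₁ : L →+* ℂ} {V : HermSpace3 L ι₁} (Γ : Level V)
    (K : CMField) (Ψ : CMType K) (σ : K →+* ℂ) :
    (U.restrictObj Q hQ).Uiso Γ K Ψ σ = U.Uiso Γ K Ψ σ := rfl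

end defeq

/-! ### Iterated products commute with the inclusion -/

/-- (Ported verbatim from the HodgeCMPerL package; no docstring in the source.) -/
theorem prodFin_restrictObj_val : ∀ (n : ℕ) (X : Fin (n + 1) → (U.restrictObj Q hQ).Var),
    ((U.restrictObj Q hQ).prodFin n X).1 = U.prodFin n (fun j => (X j).1)
  | 0, _ => rfl
  | n + 1, X => by
      show U.prod ((U.restrictObj Q hQ).prodFin n (fun i => X i.castSucc)).1 (X (Fin.last (n + 1))).1
        = U.prod (U.prodFin n (fun i => (X i.castSucc).1)) (X (Fin.last (n + 1))).1
      rw [prodFin_restrictObj_val n]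

/-- (Ported verbatim from the HodgeCMPerL package; no docstring in the source.) -/
theorem cmProd_restrictObj_val (F : CMField) {n : ℕ} (Θ : Fin (n + 1) → CMType F) :
    ((U.restrictObj Q hQ).cmProd F Θ).1 = U.cmProd F Θ :=
  prodFin_restrictObj_val hQ n _

/-- a morphism into `Y`, read as a morphism into `Y' = Y` -/
def Mor.castR {X Y Y' : U.Var} (e : Y = Y') (s : U.Mor X Y) : U.Mor X Y' := e ▸ s

/-- a morphism out of `Y`, read as a morphism out of `Y' = Y` -/
def Mor.castL {X Y Y' : U.Var} (e : Y = Y') (π : U.Mor Y X) : U.Mor Y' X := e ▸ π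

omit hQ in
/-- (Ported verbatim from the HodgeCMPerL package; no docstring in the source.) -/
theorem comp_castR_castL {X Y Y' : U.Var} (e : Y = Y') (s : U.Mor X Y) (π : U.Mor Y X) :
    U.comp (Mor.castR e s) (Mor.castL e π) = U.comp s π := by
  subst e
  rfl

/-! ### Transport of the 28 named facts -/

section facts

/-- (Ported verbatim from the HodgeCMPerL package; no docstring in the source.) -/
theorem restrictObj_pull_id (h : U.Fact_pull_id) : (U.restrictObj Q hQ).Fact_pull_id :=
  fun X k => h X.1 k

/-- (Ported verbatim from the HodgeCMPerL package; no docstring in the source.) -/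
theorem restrictObj_pull_comp (h : U.Fact_pull_comp) : (U.restrictObj Q hQ).Fact_pull_comp :=
  fun X Y Z f g k => h X.1 Y.1 Z.1 f g k

/-- (Ported verbatim from the HodgeCMPerL package; no docstring in the source.) -/
theorem restrictObj_pull_cup (h : U.Fact_pull_cup) : (U.restrictObj Q hQ).Fact_pull_cup :=
  fun X Y f i j x y => h X.1 Y.1 f i j x y

/-- (Ported verbatim from the HodgeCMPerL package; no docstring in the source.) -/
theorem restrictObj_pull_hodge (h : U.Fact_pull_hodge) : (U.restrictObj Q hQ).Fact_pull_hodge :=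
  fun X Y f k p => h X.1 Y.1 f k p

/-- (Ported verbatim from the HodgeCMPerL package; no docstring in the source.) -/
theorem restrictObj_cup2_hodge (h : U.Fact_cup2_hodge) : (U.restrictObj Q hQ).Fact_cup2_hodge :=
  fun X k p q x y hx hy => h X.1 k p q x y hx hy

/-- (Ported verbatim from the HodgeCMPerL package; no docstring in the source.) -/
theorem restrictObj_tr_degree (h : U.Fact_tr_degree) : (U.restrictObj Q hQ).Fact_tr_degree :=
  fun X k hk => h X.1 k hk

/-- (Ported verbatim from the HodgeCMPerL package; no docstring in the source.) -/
theorem restrictObj_alg_le_hodge (h : U.Fact_alg_le_hodge) : (U.restrictObj Q hQ).Fact_alg_le_hodge :=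
  fun X p => h X.1 p

/-- (Ported verbatim from the HodgeCMPerL package; no docstring in the source.) -/
theorem restrictObj_pull_alg (h : U.Fact_pull_alg) : (U.restrictObj Q hQ).Fact_pull_alg :=
  fun X Y f p => h X.1 Y.1 f p

/-- (Ported verbatim from the HodgeCMPerL package; no docstring in the source.) -/
theorem restrictObj_cup_alg (h : U.Fact_cup_alg) : (U.restrictObj Q hQ).Fact_cup_alg :=
  fun X x y hx hy => h X.1 x y hx hy

/-- (Ported verbatim from the HodgeCMPerL package; no docstring in the source.) -/
theorem restrictObj_Lefschetz11 (h : U.Fact_Lefschetz11) : (U.restrictObj Q hQ).Fact_Lefschetz11 :=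
  fun X => h X.1

/-- (Ported verbatim from the HodgeCMPerL package; no docstring in the source.) -/
theorem restrictObj_cmAV (h : U.Fact_cmAV) : (U.restrictObj Q hQ).Fact_cmAV :=
  fun K Φ => h K Φ

/-- (Ported verbatim from the HodgeCMPerL package; no docstring in the source.) -/
theorem restrictObj_eigenLine_fact (h : U.Fact_eigenLine) : (U.restrictObj Q hQ).Fact_eigenLine :=
  fun K Φ σ => h K Φ σ

/-- (Ported verbatim from the HodgeCMPerL package; no docstring in the source.) -/
theorem restrictObj_alphaLine_fact (h : U.Fact_alphaLine) : (U.restrictObj Q hQ).Fact_alphaLine :=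
  fun K Φ σ => h K Φ σ

/-- (Ported verbatim from the HodgeCMPerL package; no docstring in the source.) -/
theorem restrictObj_cmDominated (h : U.Fact_cmDominated) : (U.restrictObj Q hQ).Fact_cmDominated := by
  intro X hX
  obtain ⟨F, hF, h6, n, Θ, s, π, N, hN, hk⟩ := h X.1 hX
  have e : U.cmProd F Θ = ((U.restrictObj Q hQ).cmProd F Θ).1 := (cmProd_restrictObj_val hQ F Θ).symm
  refine ⟨F, hF, h6, n, Θ, (show U.Mor X.1 ((U.restrictObj Q hQ).cmProd F Θ).1 from Mor.castR e s),
    (show U.Mor ((U.restrictObj Q hQ).cmProd F Θ).1 X.1 from Mor.castL e π), N, hN, fun k => ?_⟩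
  show U.pull (U.comp (Mor.castR e s) (Mor.castL e π)) k = _
  rw [comp_castR_castL]
  exact hk k

/-- (Ported verbatim from the HodgeCMPerL package; no docstring in the source.) -/
theorem restrictObj_weilLine_rank (h : U.Fact_weilLine_rank) : (U.restrictObj Q hQ).Fact_weilLine_rank := by
  intro K Φ
  rw [restrictObj_weilLine]
  exact h K Φ

/-- (Ported verbatim from the HodgeCMPerL package; no docstring in the source.) -/
theorem restrictObj_weilLine_hodge (h : U.Fact_weilLine_hodge) : (U.restrictObj Q hQ).Fact_weilLine_hodge := by
  intro K f
  rw [restrictObj_weilLine]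
  exact h K f

/-- (Ported verbatim from the HodgeCMPerL package; no docstring in the source.) -/
theorem restrictObj_pmsDimTwo (h : U.PmsDimTwo) : (U.restrictObj Q hQ).PmsDimTwo :=
  fun L ι₁ V Γ => h L ι₁ V Γ

/-- (Ported verbatim from the HodgeCMPerL package; no docstring in the source.) -/
theorem restrictObj_lift (h : U.Fact_lift) : (U.restrictObj Q hQ).Fact_lift :=
  fun X Y Z f g => h X.1 Y.1 Z.1 f g

/-- (Ported verbatim from the HodgeCMPerL package; no docstring in the source.) -/
theorem restrictObj_cup_comm1 (h : U.Fact_cup_comm1) : (U.restrictObj Q hQ).Fact_cup_comm1 :=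
  fun X a b => h X.1 a b

/-- (Ported verbatim from the HodgeCMPerL package; no docstring in the source.) -/
theorem restrictObj_cup_interchange (h : U.Fact_cup_interchange) : (U.restrictObj Q hQ).Fact_cup_interchange :=
  fun X a b c d => h X.1 a b c d

/-- (Ported verbatim from the HodgeCMPerL package; no docstring in the source.) -/
theorem restrictObj_kunneth1 (h : U.Fact_kunneth1) : (U.restrictObj Q hQ).Fact_kunneth1 :=
  fun X Y => h X.1 Y.1

/-- (Ported verbatim from the HodgeCMPerL package; no docstring in the source.) -/
theorem restrictObj_H1_rank (h : U.Fact_H1_rank) : (U.restrictObj Q hQ).Fact_H1_rank :=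
  fun K Φ => h K Φ

/-- (Ported verbatim from the HodgeCMPerL package; no docstring in the source.) -/
theorem restrictObj_H4_span (h : U.Fact_H4_span) : (U.restrictObj Q hQ).Fact_H4_span :=
  fun K Φ => h K Φ

/-- (Ported verbatim from the HodgeCMPerL package; no docstring in the source.) -/
theorem restrictObj_cmEnd (h : U.Fact_cmEnd) : (U.restrictObj Q hQ).Fact_cmEnd :=
  fun K Φ a => h K Φ a

/-- (Ported verbatim from the HodgeCMPerL package; no docstring in the source.) -/
theorem restrictObj_conjIsogeny (h : U.Fact_conjIsogeny) : (U.restrictObj Q hQ).Fact_conjIsogeny :=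
  fun K Φ Φ' hΦ => h K Φ Φ' hΦ

/-- (Ported verbatim from the HodgeCMPerL package; no docstring in the source.) -/
theorem restrictObj_gysin_surface (h : U.Fact_gysin_surface) : (U.restrictObj Q hQ).Fact_gysin_surface :=
  fun S X f hS => h S.1 X.1 f hS

/-- (Ported verbatim from the HodgeCMPerL package; no docstring in the source.) -/
theorem restrictObj_deg_diag (h : U.Fact_deg_diag) : (U.restrictObj Q hQ).Fact_deg_diag := by
  intro K Φ a M hM k
  rw [restrictObj_isDiagAct] at hM
  exact h K Φ a M hM k

/-- (Ported verbatim from the HodgeCMPerL package; no docstring in the source.) -/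
theorem restrictObj_algDuality (h : U.Fact_algDuality) : (U.restrictObj Q hQ).Fact_algDuality := by
  intro K Φ
  obtain ⟨D, hD, hDalg, hDact⟩ := h K Φ
  refine ⟨D, hD, hDalg, fun a Ma Mb ha hb => ?_⟩
  rw [restrictObj_isDiagAct] at ha hb
  exact hDact a Ma Mb ha hb

/-- **the model axioms descend to every constructor-closed sub-universe** -/
theorem ModelAxioms.restrictObj (M : U.ModelAxioms) : (U.restrictObj Q hQ).ModelAxioms where
  pull_id := restrictObj_pull_id hQ M.pull_id
  pull_comp := restrictObj_pull_comp hQ M.pull_comp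
  pull_cup := restrictObj_pull_cup hQ M.pull_cup
  pull_hodge := restrictObj_pull_hodge hQ M.pull_hodge
  cup2_hodge := restrictObj_cup2_hodge hQ M.cup2_hodge
  tr_degree := restrictObj_tr_degree hQ M.tr_degree
  alg_le_hodge := restrictObj_alg_le_hodge hQ M.alg_le_hodge
  pull_alg := restrictObj_pull_alg hQ M.pull_alg
  cup_alg := restrictObj_cup_alg hQ M.cup_alg
  lefschetz11 := restrictObj_Lefschetz11 hQ M.lefschetz11
  cmAV := restrictObj_cmAV hQ M.cmAV
  eigenLine := restrictObj_eigenLine_fact hQ M.eigenLine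
  alphaLine := restrictObj_alphaLine_fact hQ M.alphaLine
  cmDominated := restrictObj_cmDominated hQ M.cmDominated
  weilLine_rank := restrictObj_weilLine_rank hQ M.weilLine_rank
  weilLine_hodge := restrictObj_weilLine_hodge hQ M.weilLine_hodge
  pms_dim := restrictObj_pmsDimTwo hQ M.pms_dim
  lift := restrictObj_lift hQ M.lift
  cup_comm1 := restrictObj_cup_comm1 hQ M.cup_comm1
  cup_interchange := restrictObj_cup_interchange hQ M.cup_interchange
  kunneth1 := restrictObj_kunneth1 hQ M.kunneth1
  H1_rank := restrictObj_H1_rank hQ M.H1_rank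
  H4_span := restrictObj_H4_span hQ M.H4_span
  cmEnd := restrictObj_cmEnd hQ M.cmEnd
  conjIsogeny := restrictObj_conjIsogeny hQ M.conjIsogeny
  gysin_surface := restrictObj_gysin_surface hQ M.gysin_surface
  deg_diag := restrictObj_deg_diag hQ M.deg_diag
  algDuality := restrictObj_algDuality hQ M.algDuality

end facts

/-! ### Transport of theta realisations and of the two realisation inputs -/

/-- a theta realisation of `U` IS a theta realisation of every sub-universe (the Picard modular surfaces, their
cohomology, the isotypic pieces `Uiso`, `H^{1,0}` and the period being those of `U`) -/
def ThetaRealisation.restrictObj {L : CMField} {ι₁ : L →+* ℂ} {V : HermSpace3 L ι₁} {K : CMField}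
    {Ψ : Fin 4 → CMType K} {σ : K →+* ℂ} (R : U.ThetaRealisation ι₁ V K Ψ σ) :
    (U.restrictObj Q hQ).ThetaRealisation ι₁ V K Ψ σ where
  H := R.H
  HG := R.HG
  CG := R.CG
  G := R.G
  SK := R.SK
  SigIdx := R.SigIdx
  SigIdxG := R.SigIdxG
  S := R.S
  Λ := R.Λ
  Theta := R.Theta
  Theta_sub := R.Theta_sub
  lineField := R.lineField
  gen12 := R.gen12
  real34 := R.real34
  cover := R.cover
  Λ_cover := R.Λ_cover
  level_inf := R.level_inf
  inner_Λ := R.inner_Λ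

/-- (Ported verbatim from the HodgeCMPerL package; no docstring in the source.) -/
theorem restrictObj_realisationExistsPerL (h : U.RealisationExistsPerL) :
    (U.restrictObj Q hQ).RealisationExistsPerL :=
  fun K L j h₁ h₂ h₃ φ hφ ι₁ hι t ht V =>
    (h K L j h₁ h₂ h₃ φ hφ ι₁ hι t ht V).map (ThetaRealisation.restrictObj hQ)

/-- (Ported verbatim from the HodgeCMPerL package; no docstring in the source.) -/
theorem restrictObj_realisationExistsFace (h : U.RealisationExistsFace) :
    (U.restrictObj Q hQ).RealisationExistsFace :=
  fun F hF h6 f ι₁ hadm V => (h F hF h6 f ι₁ hadm V).map (ThetaRealisation.restrictObj hQ)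

end

end HodgeCM.Universe
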